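import Mathlib
import Literature.Probability.RandomPlanarGeometry.ChordalRestrictionMarkov
import Literature.Probability.RandomPlanarGeometry.CurveClassStopAtMeasurable
import HarnessLib

/-!
# A.e. uniqueness of the Markov disintegration kernel at one closed set

Crux `AxiomsOfLimit` (stmt-CriticalPhenomena-1370), line `registered`, stub
`stub_markovKernelAEUnique` (lead c5). Theorems only.

The `markov` clause of `ChordalFamily.IsMarkovExtension` at a closed set `F` says that a map
`Q : CurveClass ℂ → Measure (CurveClass ℂ)` disintegrates the finite measure `μ` along the past
`γ ↦ γ.stopAt F` against the future `γ ↦ γ.startFrom F`: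
`μ (stopAt F ⁻¹' S ∩ startFrom F ⁻¹' T) = ∫⁻ γ in stopAt F ⁻¹' S, Q (γ.stopAt F) T ∂μ`.
This file proves that two such kernels with measurable evaluations agree, as measures, at the
past `γ.stopAt F` of `μ`-a.e. `γ`.

Proof: push forward to `ρ := μ.map (stopAt F)`; for each measurable `T` the two evaluations have
the same integral over every measurable `S`, hence agree `ρ`-a.e.
(`ae_eq_of_forall_setLIntegral_eq_of_sigmaFinite`); the Borel σ-algebra of the Polish space
`CurveClass ℂ` is generated by a countable set algebra, so `ρ`-a.e. the two (a.e. finite) measures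
agree on a countable generating π-system and on `univ`, hence are equal
(`ext_of_generate_finite`); finally pull back along `stopAt F` (`ae_of_ae_map`).

References: O. Kallenberg, *Foundations of Modern Probability* (3rd ed., 2021), Thm. 8.5
(uniqueness of regular conditional distributions). All [folklore].
-/

noncomputable section

open MeasureTheory Set
open scoped ENNReal

namespace Summit.CriticalPhenomena.SAWScalingLimit.Theorems.AxiomsOfLimitKernelClause

open Literature.Probability.RandomPlanarGeometry

namespace AEUnique

/-- **Measure-valued maps that agree a.e. setwise agree a.e.** On a countably generated target,
if `Q₁ p T = Q₂ p T` for `ρ`-a.e. `p`, for every measurable `T`, and `Q₁ p` is a.e. finite, then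
`Q₁ p = Q₂ p` for `ρ`-a.e. `p`: a.e. the two measures agree on the countable set algebra generated
by a countable generating family (a π-system generating the σ-algebra) and on `univ`.
[folklore] -/
theorem ae_eq_of_forall_ae_apply_eq {Ω E : Type*} [MeasurableSpace Ω] [MeasurableSpace E]
    [MeasurableSpace.CountablyGenerated E] {ρ : Measure Ω} {Q₁ Q₂ : Ω → Measure E}
    (hfin : ∀ᵐ p ∂ρ, Q₁ p univ < ∞)
    (h : ∀ T : Set E, MeasurableSet T → (fun p => Q₁ p T) =ᵐ[ρ] fun p => Q₂ p T) :
    ∀ᵐ p ∂ρ, Q₁ p = Q₂ p := by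
  -- a countable generating set algebra
  set 𝒜 := generateSetAlgebra (MeasurableSpace.countableGeneratingSet E) with h𝒜
  have h𝒜c : 𝒜.Countable :=
    countable_generateSetAlgebra (MeasurableSpace.countable_countableGeneratingSet (α := E))
  have h𝒜gen : ‹MeasurableSpace E› = MeasurableSpace.generateFrom 𝒜 := by
    rw [h𝒜, generateFrom_generateSetAlgebra_eq, MeasurableSpace.generateFrom_countableGeneratingSet]
  have h𝒜meas : ∀ A ∈ 𝒜, MeasurableSet A := fun A hA => by
    have hA' := MeasurableSpace.measurableSet_generateFrom hA
    rwa [← h𝒜gen] at hA'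
  have h𝒜pi : IsPiSystem 𝒜 := fun s hs t ht _ => isSetAlgebra_generateSetAlgebra.inter_mem hs ht
  have hall : ∀ᵐ p ∂ρ, ∀ A ∈ 𝒜, Q₁ p A = Q₂ p A := by
    rw [ae_ball_iff h𝒜c]
    intro A hA
    exact h A (h𝒜meas A hA)
  filter_upwards [hall, hfin, h univ MeasurableSet.univ] with p hp hpfin hpuniv
  haveI : IsFiniteMeasure (Q₁ p) := ⟨hpfin⟩
  exact ext_of_generate_finite 𝒜 h𝒜gen h𝒜pi hp hpuniv

/-- **Change of variables for the disintegration integrals**: for measurable `g`, measurable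
`S`, and a map `Q` with measurable evaluation at `T`,
`∫⁻ p in S, Q p T ∂(μ.map g) = ∫⁻ γ in g ⁻¹' S, Q (g γ) T ∂μ`. [folklore] -/
theorem setLIntegral_map_apply {Ω E : Type*} [MeasurableSpace Ω] [MeasurableSpace E]
    {μ : Measure Ω} {g : Ω → Ω} (hg : Measurable g) {Q : Ω → Measure E} {T : Set E}
    (hQ : Measurable fun p => Q p T) {S : Set Ω} (hS : MeasurableSet S) :
    ∫⁻ p in S, Q p T ∂(μ.map g) = ∫⁻ γ in g ⁻¹' S, Q (g γ) T ∂μ :=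
  setLIntegral_map hS hQ hg

end AEUnique

/-- **A.e. uniqueness of the Markov disintegration kernel.** Let `μ` be a finite measure on curve
classes, `F ⊆ ℂ` closed, and `Q₁, Q₂ : CurveClass ℂ → Measure (CurveClass ℂ)` two maps with
measurable evaluations, both disintegrating `μ` along the past at `F`:
`μ (stopAt F ⁻¹' S ∩ startFrom F ⁻¹' T) = ∫⁻ γ in stopAt F ⁻¹' S, Qᵢ (γ.stopAt F) T ∂μ` for all
measurable `S, T`. Then `Q₁ (γ.stopAt F) = Q₂ (γ.stopAt F)` for `μ`-a.e. `γ` (Kallenberg,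
*Foundations of Modern Probability*, uniqueness of regular conditional distributions).
[folklore] -/
theorem stub_markovKernelAEUnique : ∀ (μ : MeasureTheory.Measure (Literature.Probability.RandomPlanarGeometry.CurveClass ℂ)) [MeasureTheory.IsFiniteMeasure μ] (F : Set ℂ), IsClosed F → ∀ (Q₁ Q₂ : Literature.Probability.RandomPlanarGeometry.CurveClass ℂ → MeasureTheory.Measure (Literature.Probability.RandomPlanarGeometry.CurveClass ℂ)), (∀ T : Set (Literature.Probability.RandomPlanarGeometry.CurveClass ℂ), MeasurableSet T → Measurable fun p : Literature.Probability.RandomPlanarGeometry.CurveClass ℂ => Q₁ p T) → (∀ T : Set (Literature.Probability.RandomPlanarGeometry.CurveClass ℂ), MeasurableSet T → Measurable fun p : Literature.Probability.RandomPlanarGeometry.CurveClass ℂ => Q₂ p T) → (∀ S T : Set (Literature.Probability.RandomPlanarGeometry.CurveClass ℂ), MeasurableSet S → MeasurableSet T → μ (Literature.Probability.RandomPlanarGeometry.CurveClass.stopAt F ⁻¹' S ∩ Literature.Probability.RandomPlanarGeometry.CurveClass.startFrom F ⁻¹' T) = MeasureTheory.lintegral (μ.restrict (Literature.Probability.RandomPlanarGeometry.CurveClass.stopAt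 F ⁻¹' S)) (fun γ => Q₁ (γ.stopAt F) T)) → (∀ S T : Set (Literature.Probability.RandomPlanarGeometry.CurveClass ℂ), MeasurableSet S → MeasurableSet T → μ (Literature.Probability.RandomPlanarGeometry.CurveClass.stopAt F ⁻¹' S ∩ Literature.Probability.RandomPlanarGeometry.CurveClass.startFrom F ⁻¹' T) = MeasureTheory.lintegral (μ.restrict (Literature.Probability.RandomPlanarGeometry.CurveClass.stopAt F ⁻¹' S)) (fun γ => Q₂ (γ.stopAt F) T)) → Filter.Eventually (fun γ : Literature.Probability.RandomPlanarGeometry.CurveClass ℂ => Q₁ (γ.stopAt F) = Q₂ (γ.stopAt F)) (MeasureTheory.ae μ) := by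
  intro μ _ F hF Q₁ Q₂ hQ₁ hQ₂ h₁ h₂
  have hg : Measurable (CurveClass.stopAt F : CurveClass ℂ → CurveClass ℂ) :=
    CurveClass.measurable_stopAt hF
  -- setwise a.e. agreement on the law `μ.map (stopAt F)` of the past
  have hae : ∀ T : Set (CurveClass ℂ), MeasurableSet T →
      (fun p => Q₁ p T) =ᵐ[μ.map (CurveClass.stopAt F)] fun p => Q₂ p T := by
    intro T hT
    refine ae_eq_of_forall_setLIntegral_eq_of_sigmaFinite (hQ₁ T hT) (hQ₂ T hT) fun S hS _ => ?_
    rw [AEUnique.setLIntegral_map_apply hg (hQ₁ T hT) hS,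
      AEUnique.setLIntegral_map_apply hg (hQ₂ T hT) hS, ← h₁ S T hS hT, ← h₂ S T hS hT]
  -- a.e. finiteness of the total mass
  have hfin : ∀ᵐ p ∂(μ.map (CurveClass.stopAt F)), Q₁ p univ < ∞ := by
    refine ae_lt_top (hQ₁ _ MeasurableSet.univ) ?_
    have huniv := AEUnique.setLIntegral_map_apply (μ := μ) hg (hQ₁ _ MeasurableSet.univ)
      MeasurableSet.univ
    rw [Measure.restrict_univ] at huniv
    rw [huniv, ← h₁ univ univ MeasurableSet.univ MeasurableSet.univ]
    exact measure_ne_top μ _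
  exact ae_of_ae_map hg.aemeasurable (AEUnique.ae_eq_of_forall_ae_apply_eq hfin hae)

end Summit.CriticalPhenomena.SAWScalingLimit.Theorems.AxiomsOfLimitKernelClause

end
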